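import Summits.BirchSwinnertonDyer.BirchSwinnertonDyer.Theorems.EdixhovenFibreFiveSevenStarredOptimalManinUnitFiveSevenTransportedHodgePairHneOmega
import Literature.NumberTheory.PAdicHodge.AinfRamifiedOmegaPeriodNonvanishingOrdinary
import Literature.NumberTheory.PAdicHodge.UnitRootFrameReciprocityFormalPoint
import HarnessLib

/-!
# The unit-root frame is non-degenerate: `H₀ = ι(A)·f(LT v₀) + ι(B)·f(φ LT v₀) ≠ 0` at every ORDINARY good `𝒪_D`-model (T2 of LOC@ord)

Cell `pub/bsd-wall`, D-0145 line `route-BirchSwinnertonDyer-EdixhovenFibreFiveSeven` (DORMANT), seat `bsd-line-edix-p1` (LEAD gen 32); crux K★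
`stmt-BirchSwinnertonDyer-22226` (`StarredOptimalManinUnitFiveSeven`), line `kato_lever`, stub `stub_localFormulaOrdinaryCells`, memo
`Cruxes/StarredOptimalManinUnitFiveSeven/Lines/kato-lever-seam-rec-at-cells.md` §17–§18 («UNIT-ROOT FRAME», input `hne`). THEOREMS ONLY; helper
`--supports stmt-BirchSwinnertonDyer-22226`. **BSD is not proved by this file, and neither is K★.**

The ONE conceptual gap left by `UnitRootFrameReciprocityFormalPoint.exists_const_tatePairingPoint_eq_neg_trace_unitRoot_formalPoint` (gen 31) was its
hypothesis `hne : H₀ ≠ 0`. It is discharged here from the cells' data alone: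

* the Hodge combination IS the ω-period — `ι(p^cA)·f(LT τ) + ι(p^cB)·f(φ LT τ) = p^{N+c}·∫_τ ω_{W_D}` for EVERY `τ ∈ T_pŴ_D` (tree, height-agnostic:
  `TransportedHodgePairHneOmega.exists_hodgePair_fil_and_hne`, from `TransportedHodgeLineBdRPos` (ID));
* `∫_{v₀} ω_{W_D} ≠ 0` for a generator `v₀` of `T_pŴ_D` at HEIGHT ONE — the new (N1″) `AinfRamTop.omegaPeriod_seqO_ne_zero_of_generator`
  (tree `AinfRamifiedOmegaPeriodNonvanishingOrdinary`: `ϖ`-adic descent along the tower of Fontaine elements, no supersingular shape).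

Results: §1 `isUnit_algebraMap_coeff_of_map` (the `h1`-currency `[Xᵖ][p]_{W⊗_ψ𝒪_F} ∈ 𝒪_{ℂ_F}ˣ` ⟹ `[Xᵖ][p]_W ∈ 𝒪_{ℂ_F}ˣ`); §2 ★★★
`exists_hodgeLine_and_hne_of_isUnit` (generic `F`: a Hodge line `(A, B, d)` WITH its analytic bound and `H₀(v₀) ≠ 0`, in both the `B_dR⁺`-currencies);
§3 ★★★★ `exists_const_tatePairingPoint_eq_neg_trace_unitRoot_formalPoint_of_isUnit` — gen 31's ordinary reciprocity law at `F = K_v` with the inputs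
`(A, B, dHL, hHL, hne)` REMOVED (replaced by `p ≠ 2` and `h1`).

References: [cite: Kato1993LNM1553, Ch. II Thm. 1.4.1 and Lemma 1.4.3] · [cite: Fontaine1982FormesDifferentielles, §5] · [cite: Tate1967, §4] ·
[cite: Katz1981CrystallineDieudonne, Thm. 5.1.4] · [cite: Colmez1992PeriodesAbeliennes, §2] · [cite: SilvermanAEC2009, IV.4.4, IV.7, VII.2.2].
-/

set_option autoImplicit false
-- single-conjunct summit: `Summit.BirchSwinnertonDyer.BirchSwinnertonDyer.…` repeats the name by design
set_option linter.dupNamespace false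

noncomputable section

open scoped Classical
open ValuativeRel Field Ideal WittVector Finset Literature.NumberTheory.PAdicHodge Literature.NumberTheory.GaloisRepresentations
  Literature.NumberTheory.GaloisRepresentations.IsNonarchimedeanLocalField Literature.NumberTheory.GaloisRepresentations.LubinTate
  Literature.RingTheory.FormalGroups Literature.NumberTheory.PAdicHodge.GaloisContinuity Literature.NumberTheory.EllipticCurves
  Literature.NumberTheory.GaloisCohomology Literature.NumberTheory.EllipticCurves.FormalGroupChart Literature.IUT.LogVolume
  Literature.AlgebraicGeometry.Resolution NumberField IsDedekindDomain _root_.WeierstrassCurve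

namespace Summit.BirchSwinnertonDyer.BirchSwinnertonDyer.Theorems.UnitRootFrameNondegeneracy

section Generic

variable {F : Type} [Field F] [ValuativeRel F] [TopologicalSpace F] [IsNonarchimedeanLocalField F] [CharZero F]
  {p : ℕ} [hpp : Fact p.Prime] [Fact (¬ IsUnit (p : integerC F))] [IsAdicComplete (Ideal.span {(p : integerC F)}) (integerC F)]
  {hp : valuation F p < 1} (D : EisensteinRoot F p hp) {hθ : Function.Surjective (fontaineTheta (integerC F) p)} [CharZero (CompletedAlgClosure F)]
  (W : WeierstrassCurve (EisensteinRoot.CoeffDisc D)) (E₀ : WeierstrassCurve ℤ)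
  (hWE : W.map (Ideal.Quotient.mk (Ideal.span {EisensteinRoot.CoeffDisc.of D (AdjoinRoot.root D.poly)})) =
    (E₀.map (algebraMap ℤ (EisensteinRoot.CoeffDisc D))).map
      (Ideal.Quotient.mk (Ideal.span {EisensteinRoot.CoeffDisc.of D (AdjoinRoot.root D.poly)})))
  (ψ : EisensteinRoot.CoeffDisc D →+* LTCoeff F) (hψ : ∀ c, algebraMap (LTCoeff F) F (ψ c) = EisensteinRoot.CoeffDisc.toF D c)

/-! ## §1 The `h1`-currency -/

omit [Fact (¬ IsUnit (p : integerC F))] [IsAdicComplete (Ideal.span {(p : integerC F)}) (integerC F)] [CharZero (CompletedAlgClosure F)] in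
include hψ in
/-- **`[Xᵖ][p]_{W ⊗_ψ 𝒪_F} ∈ 𝒪_{ℂ_F}ˣ ⟹ [Xᵖ][p]_W ∈ 𝒪_{ℂ_F}ˣ`** (`[p]` commutes with base change; `𝒪_D → 𝒪_F → 𝒪_{ℂ_F}` is `𝒪_D → 𝒪_{ℂ_F}`): the
height-one hypothesis `h1` of `FormalTateModuleRankOne` / `FormalGroupDivisionHeightOne` read over `𝒪_D`. [cite: SilvermanAEC2009, IV.4.4 and IV.7] -/
theorem isUnit_algebraMap_coeff_of_map
    (h1 : IsUnit (algebraMap (LTCoeff F) (CBall F) (PowerSeries.coeff p ((W.map ψ).formalMul p)))) :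
    IsUnit (algebraMap (EisensteinRoot.CoeffDisc D) (CBall F) (PowerSeries.coeff p (W.formalMul p))) := by
  rw [← WeierstrassCurve.map_formalMul, PowerSeries.coeff_map, AinfRamTop.algebraMap_ψ_eq ψ hψ] at h1
  exact h1

/-! ## §2 A Hodge line with `H₀(v₀) ≠ 0` (generic `F`) -/

omit [Fact (¬ IsUnit (p : integerC F))] [IsAdicComplete (Ideal.span {(p : integerC F)}) (integerC F)] [CharZero (CompletedAlgClosure F)] in
/-- `algebraMap F ℂ_F (Σ aᵢ ϖⁱ) = Σ aᵢ ϖ_ℂⁱ`. [cite: SerreLocalFields1979, Ch. II §5] -/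
theorem algebraMap_sum_mul_root_pow (a : Fin D.e → PadicBase F p hp) :
    algebraMap F (CompletedAlgClosure F) (∑ i : Fin D.e, algebraMap (PadicBase F p hp) F (a i) * D.root ^ (i : ℕ)) =
      ∑ i : Fin D.e, algebraMap F (CompletedAlgClosure F) (algebraMap (PadicBase F p hp) F (a i)) *
        ((D.rootC : integerC F) : CompletedAlgClosure F) ^ (i : ℕ) := by
  rw [map_sum]
  refine Finset.sum_congr rfl fun i _ => ?_
  rw [map_mul, map_pow]
  rfl

omit [CharZero (CompletedAlgClosure F)] in
/-- From `ι(p^c·A)·X + ι(p^c·B)·Y ≠ 0` in `BdRPlusTop` to `ι(A)·X + ι(B)·Y ≠ 0` in `B_dR⁺` (factor out `ι(p^c)`). [cite: Colmez1992PeriodesAbeliennes, §2] -/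
theorem pair_ne_zero_of_pow_mul_pair_ne_zero (hθ' : Function.Surjective (fontaineTheta (integerC F) p)) (c : ℕ) {A B : F}
    {X Y : BDeRhamPlus (integerC F) p}
    (h : BdRPlusTop.of F p (embBdRHom hp hθ' ((p : F) ^ c * A)) * BdRPlusTop.of F p X +
      BdRPlusTop.of F p (embBdRHom hp hθ' ((p : F) ^ c * B)) * BdRPlusTop.of F p Y ≠ 0) :
    embBdRHom hp hθ' A * X + embBdRHom hp hθ' B * Y ≠ 0 := by
  intro h0
  apply h
  rw [map_mul (embBdRHom hp hθ'), map_mul (embBdRHom hp hθ'), map_mul (BdRPlusTop.of F p), map_mul (BdRPlusTop.of F p), mul_assoc, mul_assoc,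
    ← mul_add, ← map_mul (BdRPlusTop.of F p), ← map_mul (BdRPlusTop.of F p), ← map_add (BdRPlusTop.of F p), h0, map_zero, mul_zero]

omit [CharZero (CompletedAlgClosure F)] in
/-- From `ι(p^c·A)·X + ι(p^c·B)·Y ≠ 0` to `ι(A)·X + ι(B)·Y ≠ 0`, both read in `BdRPlusTop` (factor out `ι(p^c)`). [cite: Colmez1992PeriodesAbeliennes, §2] -/
theorem of_pair_ne_zero_of_pow_mul_pair_ne_zero (hθ' : Function.Surjective (fontaineTheta (integerC F) p)) (c : ℕ) {A B : F}
    {X Y : BDeRhamPlus (integerC F) p}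
    (h : BdRPlusTop.of F p (embBdRHom hp hθ' ((p : F) ^ c * A)) * BdRPlusTop.of F p X +
      BdRPlusTop.of F p (embBdRHom hp hθ' ((p : F) ^ c * B)) * BdRPlusTop.of F p Y ≠ 0) :
    BdRPlusTop.of F p (embBdRHom hp hθ' A) * BdRPlusTop.of F p X + BdRPlusTop.of F p (embBdRHom hp hθ' B) * BdRPlusTop.of F p Y ≠ 0 := by
  intro h0
  apply h
  rw [map_mul (embBdRHom hp hθ'), map_mul (embBdRHom hp hθ'), map_mul (BdRPlusTop.of F p), map_mul (BdRPlusTop.of F p), mul_assoc, mul_assoc,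
    ← mul_add, h0, mul_zero]

set_option maxHeartbeats 400000 in
include hWE hψ in
/-- ★★★ **The unit-root frame is non-degenerate (generic `F`).** For `W/𝒪_D ≡ E₀ (mod ϖ)` (`p ≠ 2`, `E₀ ⊗ ℚ_p`, `E₀ ⊗ 𝔽_p` elliptic), the transported period map
`LT` at `N ≥ e` (`hLT`), `[Xᵖ][p]_W ∈ 𝒪_{ℂ_F}ˣ` (HEIGHT ONE) and a generator `v₀` of `T_pŴ♭ = ℤ_p·v₀` (`W♭ = W ⊗_ψ 𝒪_F`): there are Hodge-line scalars
`A, B ∈ F` and `d` with the analytic bound `‖p^d·[Xⁿ](log_{W⊗ℂ_F} − A·log_{E₀} − B·log_{E₀}(Xᵖ))‖ ≤ 1` AND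
**`H₀ := ι(A)·f(LT v₀) + ι(B)·f(φ LT v₀) ≠ 0`** (both in `BdRPlusTop` and in `B_dR⁺`): `ι(p^cA)·f(LT v₀) + ι(p^cB)·f(φLT v₀) = p^{N+c}·∫_{v₀}ω ≠ 0`
by (ID) and (N1″). [cite: Katz1981CrystallineDieudonne, Thm. 5.1.4] [cite: Fontaine1982FormesDifferentielles, §5] [cite: Tate1967, §4]
[cite: Colmez1992PeriodesAbeliennes, §2] -/
theorem exists_hodgeLine_and_hne_of_isUnit (hp2 : p ≠ 2)
    [(E₀.map (Int.castRingHom ℚ_[p])).IsElliptic] [(E₀.map (Int.castRingHom (ZMod p))).IsElliptic]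
    {N : ℕ} (hN : D.e ≤ N) {LT : AinfTop.TatePtO F (W.map ψ) p →+ BmaxPlus F p}
    (hLT : ∀ (τ : AinfTop.TatePtO F (W.map ψ) p) (w : ℕ → (maxNilIdealC F).toIdeal) (hw : ∀ n, AinfTop.mulPC F p E₀ (w (n + 1)) = w n)
        (_ : ∀ n, ‖(((w n : (maxNilIdealC F).toIdeal) : CBall F) : CompletedAlgClosure F) -
      (((AinfTop.seqO (W.map ψ) τ n : (maxNilIdealC F).toIdeal) : CBall F) : CompletedAlgClosure F)‖ ≤ ‖((D.rootC : integerC F) : CompletedAlgClosure F)‖)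
        (z : bmaxZero F p), algebraMap (Ainf (p := p) F) (bmaxZero F p)
        ((AinfTop.of F p).symm (((AinfTop.divisionLiftPt E₀ hθ w hw).val : (AinfTop.nilTheta F p hθ).toIdeal) : AinfTop F p)) ^ N =
      (p : bmaxZero F p) * z →
        LT τ = PadicLogSeries.logSum ((algebraMap (Ainf (p := p) F) (bmaxZero F p)).comp zpToAinf) (GaloisContinuity.formalLogNum E₀ p) N
          (algebraMap (Ainf (p := p) F) (bmaxZero F p)
            ((AinfTop.of F p).symm (((AinfTop.divisionLiftPt E₀ hθ w hw).val : (AinfTop.nilTheta F p hθ).toIdeal) : AinfTop F p))) z)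
    (h1 : IsUnit (algebraMap (EisensteinRoot.CoeffDisc D) (CBall F) (PowerSeries.coeff p (W.formalMul p))))
    {v₀ : AinfTop.TatePtO F (W.map ψ) p} (hv₀ : v₀ ≠ 0) (hgen : ∀ τ : AinfTop.TatePtO F (W.map ψ) p, ∃ c : ℤ_[p], τ = c • v₀) :
    ∃ (A B : F) (d : ℕ),
      (∀ n : ℕ, ‖(p : CompletedAlgClosure F) ^ d * PowerSeries.coeff n
        ((W.map ((CBall F).subtype.comp (EisensteinRoot.CoeffDisc.toCBall D))).formalLog -
          PowerSeries.C (algebraMap F (CompletedAlgClosure F) A) * (E₀.map (Int.castRingHom (CompletedAlgClosure F))).formalLog -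
          PowerSeries.C (algebraMap F (CompletedAlgClosure F) B) *
            PowerSeries.expand p hpp.out.ne_zero (E₀.map (Int.castRingHom (CompletedAlgClosure F))).formalLog)‖ ≤ 1) ∧
      BdRPlusTop.of F p (embBdRHom hp hθ A) * BdRPlusTop.of F p (bmaxPlusToBdR F p (LT v₀)) +
          BdRPlusTop.of F p (embBdRHom hp hθ B) * BdRPlusTop.of F p (bmaxPlusToBdR F p (frobBmaxPlus F p (LT v₀))) ≠ 0 ∧
      embBdRHom hp hθ A * bmaxPlusToBdR F p (LT v₀) + embBdRHom hp hθ B * bmaxPlusToBdR F p (frobBmaxPlus F p (LT v₀)) ≠ 0 := by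
  -- the period maps `P⁰ = f ∘ LT`, `Q⁰ = f ∘ φ ∘ LT` as additive maps to `BdRPlusTop`
  obtain ⟨P₀, hP₀⟩ : ∃ P₀ : AinfTop.TatePtO F (W.map ψ) p →+ BdRPlusTop F p,
      ∀ τ, P₀ τ = BdRPlusTop.of F p (bmaxPlusToBdR F p (LT τ)) :=
    ⟨((BdRPlusTop.of F p).toAddMonoidHom.comp (bmaxPlusToBdR F p).toAddMonoidHom).comp LT, fun _ => rfl⟩
  obtain ⟨Q₀, hQ₀⟩ : ∃ Q₀ : AinfTop.TatePtO F (W.map ψ) p →+ BdRPlusTop F p,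
      ∀ τ, Q₀ τ = BdRPlusTop.of F p (bmaxPlusToBdR F p (frobBmaxPlus F p (LT τ))) :=
    ⟨(((BdRPlusTop.of F p).toAddMonoidHom.comp (bmaxPlusToBdR F p).toAddMonoidHom).comp (frobBmaxPlus F p).toAddMonoidHom).comp LT,
      fun _ => rfl⟩
  have hex := TransportedHodgePairHneOmega.exists_hodgePair_fil_and_hne D (hθ := hθ) W E₀ hWE ψ hψ hp2 hN hLT hP₀ hQ₀
  obtain ⟨a, b, d, c, hAB, -, hne⟩ := hex
  -- `∫_{v₀} ω ≠ 0` at height one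
  have hΩ := AinfRamTop.omegaPeriod_seqO_ne_zero_of_generator (hθ := hθ) W ψ hψ h1 hv₀ hgen
  have hne₁ := hne v₀ hΩ
  rw [hP₀, hQ₀] at hne₁
  refine ⟨∑ i : Fin D.e, algebraMap (PadicBase F p hp) F (a i) * D.root ^ (i : ℕ),
    ∑ i : Fin D.e, algebraMap (PadicBase F p hp) F (b i) * D.root ^ (i : ℕ), d, ?_, ?_, ?_⟩
  · intro n
    rw [algebraMap_sum_mul_root_pow, algebraMap_sum_mul_root_pow]
    exact hAB n
  · exact of_pair_ne_zero_of_pow_mul_pair_ne_zero hθ c hne₁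
  · exact pair_ne_zero_of_pow_mul_pair_ne_zero hθ c hne₁

end Generic

/-! ## §3 The ordinary reciprocity law at `F = K_v` without the Hodge-line / `hne` inputs -/

section Completion

variable {K : Type} [Field K] [NumberField K] {p : ℕ} [hprime : Fact p.Prime] (v : HeightOneSpectrum (𝓞 K))
  [CharZero (v.adicCompletion K)] [LocallyCompactSpace (absoluteGaloisGroup (v.adicCompletion K))]
  [Fact (¬ IsUnit (p : integerC (v.adicCompletion K)))]
  [IsAdicComplete (Ideal.span {(p : integerC (v.adicCompletion K))}) (integerC (v.adicCompletion K))]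
  [CharP 𝓀[v.adicCompletion K] p] [CharZero (CompletedAlgClosure (v.adicCompletion K))]
  (hpv : valuation (v.adicCompletion K) (p : v.adicCompletion K) < 1)
  (Dv : EisensteinRoot (v.adicCompletion K) p hpv) (Wm : WeierstrassCurve (EisensteinRoot.CoeffDisc Dv))
  (ψm : EisensteinRoot.CoeffDisc Dv →+* LTCoeff (v.adicCompletion K))
  (hψm : ∀ c, algebraMap (LTCoeff (v.adicCompletion K)) (v.adicCompletion K) (ψm c) = EisensteinRoot.CoeffDisc.toF Dv c)
  (hΔ : IsUnit (Wm.map ψm).Δ)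
  [(AinfTop.curveFO (v.adicCompletion K) (Wm.map ψm)).IsElliptic]
  [(curveOver (CompletedAlgClosure (v.adicCompletion K)) (Wm.map ψm)).IsElliptic]
  (e : (k : ℕ) → geomTorsion (AinfTop.curveFO (v.adicCompletion K) (Wm.map ψm)) ((p ^ k : ℕ) : ℤ) →
    geomTorsion (AinfTop.curveFO (v.adicCompletion K) (Wm.map ψm)) ((p ^ k : ℕ) : ℤ) → AlgebraicClosure (v.adicCompletion K))
  (hμ : ∀ k S T, e k S T ^ (p ^ k) = 1) (hadd₁ : ∀ k S₁ S₂ T, e k (S₁ + S₂) T = e k S₁ T * e k S₂ T)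
  (hadd₂ : ∀ k S T₁ T₂, e k S (T₁ + T₂) = e k S T₁ * e k S T₂)
  (hgal : ∀ k (σ : absoluteGaloisGroup (v.adicCompletion K))
    (S T : geomTorsion (AinfTop.curveFO (v.adicCompletion K) (Wm.map ψm)) ((p ^ k : ℕ) : ℤ)), σ • e k S T = e k (σ • S) (σ • T))
  (hcompat : ∀ k (S T : geomTorsion (AinfTop.curveFO (v.adicCompletion K) (Wm.map ψm)) ((p ^ (k + 1) : ℕ) : ℤ)),
    e k (torsionMulHom (AinfTop.curveFO (v.adicCompletion K) (Wm.map ψm)) (p ^ (k + 1)) (p ^ k) p (pow_succ p k).symm S)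
      (torsionMulHom (AinfTop.curveFO (v.adicCompletion K) (Wm.map ψm)) (p ^ (k + 1)) (p ^ k) p (pow_succ p k).symm T) =
        e (k + 1) S T ^ p)

set_option maxHeartbeats 6400000 in
include hgal hψm hΔ in
/-- ★★★★ **Kato's explicit reciprocity law at `F = K_v` for a ramified good ORDINARY model at every deep formal point with a formal division tower — with
NO Hodge-line / non-degeneracy input.** `UnitRootFrameReciprocityFormalPoint.exists_const_tatePairingPoint_eq_neg_trace_unitRoot_formalPoint` (gen 31)
with its inputs `(A, B, dHL, hHL, hne)` DISCHARGED by `exists_hodgeLine_and_hne_of_isUnit` from `p ≠ 2` and the height-one hypothesis `h1`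
(`[Xᵖ][p]_{W_D ⊗ 𝒪_F} ∈ 𝒪_{ℂ_F}ˣ`, the currency of `hcap` in `…LocalFormulaOrdinaryCellsOfCapstone`). Remaining inputs: the cell data, `LT` (`hLT/hsmul/hgalLT`,
from `exists_addMonoidHom_logSum_transport`), the generator `v₀`/`ρ` (from `FormalTateModuleRankOne.exists_generator_tatePtO_of_isUnit h1`) and the unit root `α`
(from `FrobeniusUnitRoot.exists_unitRoot_frobeniusPoly`, `‖a_p‖ = 1`). [cite: Kato1993LNM1553, Ch. II Thm. 1.4.1 (3)–(4) and Lemma 1.4.3]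
[cite: BlochKato1990, Ex. 3.10.1, Example 3.11] [cite: Fontaine1982FormesDifferentielles, §5] [cite: Tate1967, §4] [cite: SilvermanAEC2009, Prop. VII.2.2 and VIII §2] -/
theorem exists_const_tatePairingPoint_eq_neg_trace_unitRoot_formalPoint_of_isUnit (hp2 : p ≠ 2)
    (E₀ : WeierstrassCurve ℤ)
    (hWE : Wm.map (Ideal.Quotient.mk (Ideal.span {EisensteinRoot.CoeffDisc.of Dv (AdjoinRoot.root Dv.poly)})) =
      (E₀.map (algebraMap ℤ (EisensteinRoot.CoeffDisc Dv))).map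
        (Ideal.Quotient.mk (Ideal.span {EisensteinRoot.CoeffDisc.of Dv (AdjoinRoot.root Dv.poly)})))
    [(E₀.map (Int.castRingHom ℚ_[p])).IsElliptic] [(E₀.map (Int.castRingHom (ZMod p))).IsElliptic]
    {N : ℕ} (hN : Dv.e ≤ N) {LT : AinfTop.TatePtO (v.adicCompletion K) (Wm.map ψm) p →+ BmaxPlus (v.adicCompletion K) p}
    (hLT : ∀ (τ : AinfTop.TatePtO (v.adicCompletion K) (Wm.map ψm) p) (w : ℕ → (maxNilIdealC (v.adicCompletion K)).toIdeal)
        (hw : ∀ n, AinfTop.mulPC (v.adicCompletion K) p E₀ (w (n + 1)) = w n)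
        (_ : ∀ n, ‖(((w n : (maxNilIdealC (v.adicCompletion K)).toIdeal) : CBall (v.adicCompletion K)) : CompletedAlgClosure (v.adicCompletion K)) -
          (((AinfTop.seqO (Wm.map ψm) τ n : (maxNilIdealC (v.adicCompletion K)).toIdeal) : CBall (v.adicCompletion K)) :
            CompletedAlgClosure (v.adicCompletion K))‖ ≤
          ‖((Dv.rootC : integerC (v.adicCompletion K)) : CompletedAlgClosure (v.adicCompletion K))‖)
        (z : bmaxZero (v.adicCompletion K) p), algebraMap (Ainf (p := p) (v.adicCompletion K)) (bmaxZero (v.adicCompletion K) p)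
          ((AinfTop.of (v.adicCompletion K) p).symm (((AinfTop.divisionLiftPt E₀ (surjective_fontaineTheta_integerC hpv) w hw).val :
            (AinfTop.nilTheta (v.adicCompletion K) p (surjective_fontaineTheta_integerC hpv)).toIdeal) : AinfTop (v.adicCompletion K) p)) ^ N =
          (p : bmaxZero (v.adicCompletion K) p) * z →
        LT τ = PadicLogSeries.logSum ((algebraMap (Ainf (p := p) (v.adicCompletion K)) (bmaxZero (v.adicCompletion K) p)).comp zpToAinf)
          (GaloisContinuity.formalLogNum E₀ p) N
          (algebraMap (Ainf (p := p) (v.adicCompletion K)) (bmaxZero (v.adicCompletion K) p)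
            ((AinfTop.of (v.adicCompletion K) p).symm (((AinfTop.divisionLiftPt E₀ (surjective_fontaineTheta_integerC hpv) w hw).val :
              (AinfTop.nilTheta (v.adicCompletion K) p (surjective_fontaineTheta_integerC hpv)).toIdeal) : AinfTop (v.adicCompletion K) p))) z)
    (hsmul : ∀ (c : ℤ_[p]) (τ : AinfTop.TatePtO (v.adicCompletion K) (Wm.map ψm) p),
      LT (c • τ) = ainfToBmaxPlus (v.adicCompletion K) p (zpToAinf c) * LT τ)
    (hgalLT : ∀ (σ : absoluteGaloisGroup (v.adicCompletion K)) (τ : AinfTop.TatePtO (v.adicCompletion K) (Wm.map ψm) p),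
      galBmaxPlus σ (LT τ) = LT (σ • τ))
    (h1 : IsUnit (algebraMap (LTCoeff (v.adicCompletion K)) (CBall (v.adicCompletion K)) (PowerSeries.coeff p ((Wm.map ψm).formalMul p))))
    {v₀ : AinfTop.TatePtO (v.adicCompletion K) (Wm.map ψm) p} (hv₀ : v₀ ≠ 0)
    (hgen : ∀ τ : AinfTop.TatePtO (v.adicCompletion K) (Wm.map ψm) p, ∃ c : ℤ_[p], τ = c • v₀)
    (ρ : absoluteGaloisGroup (v.adicCompletion K) → ℤ_[p]) (hρv : ∀ σ : absoluteGaloisGroup (v.adicCompletion K), σ • v₀ = ρ σ • v₀)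
    {α π : ℤ_[p]} (hα : ‖α‖ = 1) (hαπ : α * π = p)
    (hαroot : α ^ 2 - ((HasseManin.tr (E₀.map (Int.castRingHom (ZMod p))) : ℤ) : ℤ_[p]) * α + p = 0)
    (haπ : α + π = ((HasseManin.tr (E₀.map (Int.castRingHom (ZMod p))) : ℤ) : ℤ_[p]))
    (ψ : C(absoluteGaloisGroup (v.adicCompletion K), ℤ_[p])) (hψ : ∀ σ τ, ψ (σ * τ) = ψ σ + ψ τ)
    (hψlog : ∀ τ, (ψ τ : ℚ_[p]) = logCyclotomic (F := (v.adicCompletion K)) p τ)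
    (heL : ∀ (c : ℤ_[p]) (S U : (AinfTop.curveFO (v.adicCompletion K) (Wm.map ψm)).tateModule p),
      (weilContPairingPadic (AinfTop.curveFO (v.adicCompletion K) (Wm.map ψm)) (v.adicCompletion K) p e hμ hadd₁ hadd₂ hgal hcompat).toLin (c • S) U =
      twistHom (v.adicCompletion K) p ((weilContPairingPadic (AinfTop.curveFO (v.adicCompletion K) (Wm.map ψm)) (v.adicCompletion K) p e hμ hadd₁ hadd₂ hgal hcompat).toLin S U) c)
    (healt : ∀ S : (AinfTop.curveFO (v.adicCompletion K) (Wm.map ψm)).tateModule p,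
      (weilContPairingPadic (AinfTop.curveFO (v.adicCompletion K) (Wm.map ψm)) (v.adicCompletion K) p e hμ hadd₁ hadd₂ hgal hcompat).toLin S S = 0)
    (henondeg : ∀ S : (AinfTop.curveFO (v.adicCompletion K) (Wm.map ψm)).tateModule p,
      (∀ U, (weilContPairingPadic (AinfTop.curveFO (v.adicCompletion K) (Wm.map ψm)) (v.adicCompletion K) p e hμ hadd₁ hadd₂ hgal hcompat).toLin S U = 0) → S = 0)
    (hinj : letI := LocalField.padicAlgebra (v.adicCompletion K) p hpv
      (bdRPeriodRingData (F := (v.adicCompletion K)) (p := p) hpv).CupLogInjective (logCyclotomic p)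
        (restrictedRationalTateRep (AinfTop.curveFO (v.adicCompletion K) (Wm.map ψm)) (v.adicCompletion K) p))
    (hde : letI := LocalField.padicAlgebra (v.adicCompletion K) p hpv
      ∀ η : contOneCocycles (restrictedTateRep (AinfTop.curveFO (v.adicCompletion K) (Wm.map ψm)) (v.adicCompletion K) p).toTopRep,
        (bdRPeriodRingData (F := (v.adicCompletion K)) (p := p) hpv).HasDualExp (logCyclotomic p)
          (restrictedRationalTateRep (AinfTop.curveFO (v.adicCompletion K) (Wm.map ψm)) (v.adicCompletion K) p)
          fun σ => TateModule.toRational p (η.1 σ))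
    (d : letI := LocalField.padicAlgebra (v.adicCompletion K) p hpv
      (bdRPeriodRingData (F := (v.adicCompletion K)) (p := p) hpv).FilZeroLine
        (restrictedRationalTateRep (AinfTop.curveFO (v.adicCompletion K) (Wm.map ψm)) (v.adicCompletion K) p)) :
    letI := LocalField.padicAlgebra (v.adicCompletion K) p hpv
    ∃ c : v.adicCompletion K,
      ∀ (η : contOneCocycles (restrictedTateRep (AinfTop.curveFO (v.adicCompletion K) (Wm.map ψm)) (v.adicCompletion K) p).toTopRep)
        (P : ((AinfTop.curveFO (v.adicCompletion K) (Wm.map ψm)).baseChange (v.adicCompletion K)).toAffine.Point)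
        (Q : ℕ → geomPoints ((AinfTop.curveFO (v.adicCompletion K) (Wm.map ψm)).baseChange (v.adicCompletion K)))
        (_hQ : ∀ n, p • Q (n + 1) = Q n)
        (_hQ0 : Q 0 = toGeomPoints ((AinfTop.curveFO (v.adicCompletion K) (Wm.map ψm)).baseChange (v.adicCompletion K)) P)
        (hker : ∀ n, AinfTop.geomToCO (Wm.map ψm) (Q n) ∈ kernel (NormedField.valuation (K := CompletedAlgClosure (v.adicCompletion K)))
          (curveOver (CompletedAlgClosure (v.adicCompletion K)) (Wm.map ψm))),
        ‖((zPt (AinfTop.geomToCO (Wm.map ψm) (Q 0)) (hker 0) : CBall (v.adicCompletion K)) : CompletedAlgClosure (v.adicCompletion K))‖ ^ N ≤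
            ‖(p : CompletedAlgClosure (v.adicCompletion K))‖ →
        ∀ cP : v.adicCompletion K,
          algebraMap (v.adicCompletion K) (CompletedAlgClosure (v.adicCompletion K)) cP =
            (p : CompletedAlgClosure (v.adicCompletion K)) ^ N *
              ∑' j : ℕ, PowerSeries.coeff j (Wm.map ((CBall (v.adicCompletion K)).subtype.comp (EisensteinRoot.CoeffDisc.toCBall Dv))).formalLog *
                ((zPt (AinfTop.geomToCO (Wm.map ψm) (Q 0)) (hker 0) : CBall (v.adicCompletion K)) : CompletedAlgClosure (v.adicCompletion K)) ^ j →
          ((tatePairingPoint (AinfTop.curveFO (v.adicCompletion K) (Wm.map ψm)) (v.adicCompletion K) p e hμ hadd₁ hadd₂ hgal hcompat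
              (oneCocycleClass _ η) P : ℤ_[p]) : ℚ_[p]) =
            -Algebra.trace ℚ_[p] (v.adicCompletion K) (cP * (expStarCoord (AinfTop.curveFO (v.adicCompletion K) (Wm.map ψm)) hpv d η * c)) := by
  -- the Hodge line and `H₀ ≠ 0` (generic `F`, STEPWISE)
  have hH1 := isUnit_algebraMap_coeff_of_map (D := Dv) (W := Wm) ψm hψm h1
  have hH2 := exists_hodgeLine_and_hne_of_isUnit (hp := hpv) (hθ := surjective_fontaineTheta_integerC hpv) Dv Wm E₀ hWE ψm hψm hp2 hN hLT
    hH1 hv₀ hgen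
  obtain ⟨A, B, dHL, hHL, -, hne⟩ := hH2
  have hF1 := exists_const_tatePairingPoint_eq_neg_trace_unitRoot_formalPoint v hpv Dv Wm ψm hψm hΔ e hμ hadd₁ hadd₂ hgal hcompat E₀ hWE hN hLT
    hsmul hgalLT hv₀ hgen ρ hρv A B dHL hHL hα hαπ hαroot haπ hne
  exact hF1 ψ hψ hψlog heL healt henondeg hinj hde d

end Completion

end Summit.BirchSwinnertonDyer.BirchSwinnertonDyer.Theorems.UnitRootFrameNondegeneracy
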